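import Literature.NumberTheory.EllipticCurves.KugaSatoSchollProjectorComponents
import Literature.AlgebraicGeometry.Motives.RestrictScalarsBettiConjugation
import HarnessLib

/-!
# `F_∞` permutes the conjugate components of a Kuga–Sato variety regarded over `ℚ`

Topic: `Literature/NumberTheory/EllipticCurves`. Complement to
`KugaSatoSchollProjectorComponents.lean` (`Hⁱ_B(W|_ℚ) ≅ ∏_σ Hⁱ_B(W_σ)` is `ℚ[Aut W]`-linear and
`Π_ε Hⁱ_B(W|_ℚ) ≅ ∏_σ Π_ε Hⁱ_B(W_σ)`) and `KugaSatoSchollProjectorFrobInfty.lean` (`Π_ε` commutes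
with `F_∞` on `Hⁱ_B(W|_ℚ)`): by `Motives.RestrictScalarsBettiConjugation`, complex conjugation of
`W|_ℚ(ℂ)` carries the component `W_σ(ℂ)` onto `W_σ̄(ℂ)`, `σ̄ = conj ∘ σ` (Deninger–Scholl (2.2) with
§4.1), and therefore:

* `conjEmb σ = σ̄` (an involution, `conjEmb_conjEmb`) and the anti-holomorphic identification
  `conjHomeomorph V σ : W_σ(ℂ) ≃ₜ W_σ̄(ℂ)` (`Motives.conjPieceHomeomorph` for `τ = conj`);
* `decomp_frobInfty` — **`decomp (F_∞ x) σ = (conjHomeomorph σ)* (decomp x σ̄)`**: the infinite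
  Frobenius of Scholl's `ℚ`-scheme is, component by component, pull-back along the
  identification of conjugate components;
* `map_conjHomeomorph_bettiActionConj` — `(conjHomeomorph σ)*` intertwines the actions of
  `ℚ[Aut W]` on `Hⁱ_B(W_σ̄)` and `Hⁱ_B(W_σ)` (the automorphisms are defined over `K`), hence
  Scholl's projector (`map_conjHomeomorph_schollProjectorBettiConj`) and the `ε`-parts
  (`map_conjHomeomorph_mem_schollPartConj`).

`K` a number field, hypothesis `[IsCommMonObj V.curve.E]` as in the companion files; no named
facts; nothing is asserted about Hodge types or about the `±`-eigenspaces beyond these identities.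

## References

* C. Deninger, A. J. Scholl, *The Beilinson conjectures*, in *L-functions and Arithmetic*,
  LMS LNS 153 (1991), (2.2) (p. 151 of the volume), §4.1 (p. 161), 5.3 (i) (p. 167).
  [DeningerScholl1991]
* A. J. Scholl, *Motives for modular forms*, Invent. Math. 100 (1990), §1. [Scholl1990]
-/

open CategoryTheory Limits AlgebraicGeometry MonoidalCategory CartesianMonoidalCategory
open scoped MonObj MatrixGroups

noncomputable section

namespace Literature.NumberTheory.EllipticCurves

namespace KugaSatoVariety

open Literature.AlgebraicGeometry.Motives Literature.NumberTheory.EllipticCurves.ModularForms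
open Literature.AlgebraicTopology.SingularHomology

variable {K : Type} [Field K] [NumberField K] {m N : ℕ} (V : KugaSatoVariety K m N)

/-! ### Complex conjugation on the embeddings and on the components -/

/-- The complex-conjugate embedding `σ̄ = conj ∘ σ : K → ℂ` of a `ℚ`-embedding `σ`. [folklore] -/
abbrev conjEmb (σ : K →ₐ[ℚ] ℂ) : K →ₐ[ℚ] ℂ :=
  (conjAlgEquivRat : ℂ →ₐ[ℚ] ℂ).comp σ

/-- `σ̄ a = conj (σ a)`. [folklore] -/
@[simp]
theorem conjEmb_apply (σ : K →ₐ[ℚ] ℂ) (a : K) : conjEmb σ a = (starRingEnd ℂ) (σ a) :=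
  rfl

/-- `σ̄̄ = σ`. [folklore] -/
theorem conjEmb_conjEmb (σ : K →ₐ[ℚ] ℂ) : conjEmb (conjEmb σ) = σ := by
  ext a
  exact Complex.conj_conj (σ a)

/-- Complex conjugation of the complex points of a `ℚ`-scheme is the action of the continuous
`ℚ`-automorphism `conj` of `ℂ` (`ModularForms.complexConjPoints` versus
`Motives.AlgPoints.smulContinuous`; same map). [folklore] -/
theorem complexConjPoints_eq_smulContinuous (W : SchemeOver ℚ) :
    complexConjPoints W = AlgPoints.smulContinuous W conjAlgEquivRat Complex.continuous_conj :=
  rfl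

/-- **The anti-holomorphic identification of conjugate components** `W_σ(ℂ) ≃ₜ W_σ̄(ℂ)` induced by
complex conjugation of `W|_ℚ(ℂ)` (`Motives.conjPieceHomeomorph` for `τ = conj`; Deninger–Scholl
(2.2), §4.1). [cite: DeningerScholl1991, (2.2) and §4.1] -/
abbrev conjHomeomorph (σ : K →ₐ[ℚ] ℂ) :
    ComplexPoints (V.conj σ) ≃ₜ ComplexPoints (V.conj (conjEmb σ)) :=
  conjPieceHomeomorph V.W σ conjAlgEquivRat Complex.continuous_conj

/-! ### `F_∞` component by component -/

/-- **`decomp (F_∞ x) σ = (conjHomeomorph σ)* (decomp x σ̄)`**: on `Hⁱ_B(W|_ℚ) ≅ ∏_σ Hⁱ_B(W_σ)`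
the infinite Frobenius carries the `σ̄`-component to the `σ`-component through the identification
of conjugate components (Deninger–Scholl (2.2), §4.1). [cite: DeningerScholl1991, (2.2) and §4.1] -/
theorem decomp_frobInfty (i : ℕ) (x : bettiCohomology (V.W.restrictScalars ℚ) i) (σ : K →ₐ[ℚ] ℂ) :
    bettiCohomologyRestrictScalarsEquiv V.W i (frobInfty (V.W.restrictScalars ℚ) i x) σ =
      singularCohomology.map ℚ ℚ (V.conjHomeomorph σ :
          C(ComplexPoints (V.conj σ), ComplexPoints (V.conj (conjEmb σ)))) i
        (bettiCohomologyRestrictScalarsEquiv V.W i x (conjEmb σ)) :=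
  bettiCohomologyRestrictScalarsEquiv_map_smulContinuous V.W conjAlgEquivRat
    Complex.continuous_conj i x σ

/-! ### The identification of conjugate components is `ℚ[Aut W]`-linear -/

/-- **`(conjHomeomorph σ)*` intertwines the actions of `ℚ[Aut W]`** on `Hⁱ_B(W_σ̄)` and `Hⁱ_B(W_σ)`
(the automorphisms of `W` are defined over `K`, so their base changes to the conjugate components
correspond under the identification; `Motives.map_conjPieceHomeomorph_map_baseChangeHom`, extended
by linearity). [cite: DeningerScholl1991, §4.1 and 5.3 (i)] -/
theorem map_conjHomeomorph_bettiActionConj (i : ℕ) (a : MonoidAlgebra ℚ (Aut V.W)) (σ : K →ₐ[ℚ] ℂ)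
    (y : bettiCohomology (V.conj (conjEmb σ)) i) :
    singularCohomology.map ℚ ℚ (V.conjHomeomorph σ :
          C(ComplexPoints (V.conj σ), ComplexPoints (V.conj (conjEmb σ)))) i
        (V.bettiActionConj (conjEmb σ) i a y) =
      V.bettiActionConj σ i a
        (singularCohomology.map ℚ ℚ (V.conjHomeomorph σ :
          C(ComplexPoints (V.conj σ), ComplexPoints (V.conj (conjEmb σ)))) i y) := by
  induction a using MonoidAlgebra.induction_on with
  | hM g =>
    rw [bettiActionConj_of, bettiActionConj_of]
    exact map_conjPieceHomeomorph_map_baseChangeHom V.W g.inv σ conjAlgEquivRat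
      Complex.continuous_conj i y
  | hadd a b ha hb =>
    rw [map_add, map_add, LinearMap.add_apply, LinearMap.add_apply, map_add, ha, hb]
  | hsmul r a ha =>
    rw [map_smul, map_smul, LinearMap.smul_apply, LinearMap.smul_apply, map_smul, ha]

/-- **`(conjHomeomorph σ)*` intertwines Scholl's projector** on `Hⁱ_B(W_σ̄)` and `Hⁱ_B(W_σ)`.
[cite: DeningerScholl1991, §4.1 and 5.3 (i)] -/
theorem map_conjHomeomorph_schollProjectorBettiConj [NeZero N] [IsCommMonObj V.curve.E] (i : ℕ)
    (σ : K →ₐ[ℚ] ℂ) (y : bettiCohomology (V.conj (conjEmb σ)) i) :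
    singularCohomology.map ℚ ℚ (V.conjHomeomorph σ :
          C(ComplexPoints (V.conj σ), ComplexPoints (V.conj (conjEmb σ)))) i
        (V.schollProjectorBettiConj (conjEmb σ) i y) =
      V.schollProjectorBettiConj σ i
        (singularCohomology.map ℚ ℚ (V.conjHomeomorph σ :
          C(ComplexPoints (V.conj σ), ComplexPoints (V.conj (conjEmb σ)))) i y) :=
  V.map_conjHomeomorph_bettiActionConj i V.schollProjector σ y

/-- **`(conjHomeomorph σ)*` carries the `ε`-part of `Hⁱ_B(W_σ̄)` into the `ε`-part of
`Hⁱ_B(W_σ)`.** [cite: DeningerScholl1991, §4.1 and 5.3 (i)] -/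
theorem map_conjHomeomorph_mem_schollPartConj [NeZero N] [IsCommMonObj V.curve.E] {i : ℕ}
    (σ : K →ₐ[ℚ] ℂ) {y : bettiCohomology (V.conj (conjEmb σ)) i}
    (hy : y ∈ V.schollPartConj (conjEmb σ) i) :
    singularCohomology.map ℚ ℚ (V.conjHomeomorph σ :
        C(ComplexPoints (V.conj σ), ComplexPoints (V.conj (conjEmb σ)))) i y ∈
      V.schollPartConj σ i := by
  rw [mem_schollPartConj_iff] at hy ⊢
  rw [← map_conjHomeomorph_schollProjectorBettiConj, hy]

/-- **`F_∞` and the `ε`-parts, component by component**: if the `σ̄`-component of `x` lies in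
`Π_ε Hⁱ_B(W_σ̄)` then the `σ`-component of `F_∞ x` lies in `Π_ε Hⁱ_B(W_σ)`.
[cite: DeningerScholl1991, (2.2), §4.1 and 5.3 (i)] -/
theorem decomp_frobInfty_mem_schollPartConj [NeZero N] [IsCommMonObj V.curve.E] {i : ℕ}
    (x : bettiCohomology (V.W.restrictScalars ℚ) i) (σ : K →ₐ[ℚ] ℂ)
    (hx : bettiCohomologyRestrictScalarsEquiv V.W i x (conjEmb σ) ∈
      V.schollPartConj (conjEmb σ) i) :
    bettiCohomologyRestrictScalarsEquiv V.W i (frobInfty (V.W.restrictScalars ℚ) i x) σ ∈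
      V.schollPartConj σ i := by
  rw [decomp_frobInfty]
  exact V.map_conjHomeomorph_mem_schollPartConj σ hx

end KugaSatoVariety

end Literature.NumberTheory.EllipticCurves

end
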